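import Summits.Ventures.LatticeQCDFlow.Scoring.NonabelianAreaLaw2DPeeling
import HarnessLib

/-!
# The exact non-abelian area law in two dimensions, IV-b: peeling the four strips of an open rectangle around an observable

HONEST FRAMING: exact (Metropolis-corrected) sampling algorithms for lattice gauge theory;
figures of merit are autocorrelation/cost numbers at stated couplings and volumes; no
continuum-physics claim.

Venture `LatticeQCDFlow` (cell pub-lqcd), sub-topic `Scoring`; FANOUT row 5 (`s0-sun-a`), GEN-18.
NEW WORK of the cell (placement rule).  For every compact second-countable gauge group `G`, every continuous
weight `w` and every continuous observable `Φ` of the links of `(ℤ/L)²`, with the weight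
`∏_{p ∈ B} w(U_p)` on an open rectangle `B` of plaquettes (coordinates `(i + a, j + b)`), the plaquettes of a
boundary strip of `B` whose PRIVATE links `Φ` ignores integrate out to a factor `∫ w` each
(strip absorption of part IV-a in the strip's private links):

* **`integral_mul_prod_rect_peel_right`** — the columns `c ≤ a < R₀` (private RIGHT links; `Φ` ignores the
  vertical links of the columns `i + c'`, `c < c'`): `∫ Φ ∏_{R₀×T₀} w = (∫w)^{(R₀−c)T₀} ∫ Φ ∏_{c×T₀} w`;
* **`integral_mul_prod_rect_peel_left`** — the columns `a < a₀` (private LEFT links, entering inverted; `Φ`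
  ignores the vertical links of the columns `i + c'`, `c' < a₀`):
  `∫ Φ ∏_{(a₀+R')×T₀ at (i,j)} w = (∫w)^{a₀T₀} ∫ Φ ∏_{R'×T₀ at (i+a₀,j)} w`;
* **`integral_mul_prod_rect_peel_top`** — the rows `c ≤ b < T₀` (private TOP links, inverted; `Φ` ignores the
  horizontal links of the rows `j + r`, `c < r`): `∫ Φ ∏_{R×T₀} w = (∫w)^{R(T₀−c)} ∫ Φ ∏_{R×c} w`;
* **`integral_mul_prod_rect_peel_bottom`** — the rows `b < b₀` (private BOTTOM links; `Φ` ignores the horizontal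
  links of the rows `j + r`, `r < b₀`): `∫ Φ ∏_{R×(b₀+T') at (i,j)} w = (∫w)^{Rb₀} ∫ Φ ∏_{R×T' at (i,j+b₀)} w`.

All for `R₀ + 1 ≤ L`, `T₀ + 1 ≤ L` (no wrap-around).  Part IV-c applies the four to a Wilson loop.
No `def`, nothing cited as a fact, 0 sorry.
-/

noncomputable section

open MeasureTheory Function Finset
open Literature.MathematicalPhysics.QuantumFieldTheory
open Literature.MathematicalPhysics.QuantumLattice
open Summit.Ventures.LatticeQCDFlow.Theory2.Lattice
open Summit.Ventures.LatticeQCDFlow.Theory2.Lattice.TwoDim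

namespace Summit.Ventures.LatticeQCDFlow.Scoring

variable {L : ℕ} [NeZero L] {G : Type*} [Group G] [TopologicalSpace G] [IsTopologicalGroup G]
  [CompactSpace G] [SecondCountableTopology G] [MeasurableSpace G] [BorelSpace G]

/-! ## §3. The four peelings -/

section Peel

variable {w : G → ℝ} (hw : Continuous w) {Φ : GaugeConfig 2 L G → ℂ} (hΦ : Continuous Φ)
include hw hΦ

/-- **Peeling the columns to the RIGHT of column `c`.**  If `Φ` ignores the vertical links of the columns
`i + c'`, `c < c' ≤ L − 1`, then for `c ≤ R₀`, `R₀ + 1 ≤ L`: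
`∫ Φ ∏_{p ∈ R₀×T₀ at (i,j)} w(U_p) = (∫w)^{(R₀−c)T₀} ∫ Φ ∏_{p ∈ c×T₀ at (i,j)} w(U_p)`. -/
theorem integral_mul_prod_rect_peel_right (i j : ZMod L) {c T₀ : ℕ} (hT₀ : T₀ + 1 ≤ L)
    (hΦe : ∀ (c' : ℕ) (y : ZMod L) (U : GaugeConfig 2 L G) (g : G), c < c' → c' + 1 ≤ L →
      Φ (update U (![i + c', y], 1) g) = Φ U) :
    ∀ (R₀ : ℕ), c ≤ R₀ → R₀ + 1 ≤ L →
      ∫ U, Φ U * ∏ p ∈ (range R₀ ×ˢ range T₀).image (fun q : ℕ × ℕ => (![i + q.1, j + q.2] : Site 2 L)),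
          (w (plaquetteHolonomy U p 0 1) : ℂ) ∂(Measure.pi fun _ : Edge 2 L => haarProbability G) =
        (∫ g, (w g : ℂ) ∂(haarProbability G)) ^ ((R₀ - c) * T₀) *
          ∫ U, Φ U * ∏ p ∈ (range c ×ˢ range T₀).image (fun q : ℕ × ℕ => (![i + q.1, j + q.2] : Site 2 L)),
            (w (plaquetteHolonomy U p 0 1) : ℂ) ∂(Measure.pi fun _ : Edge 2 L => haarProbability G) := by
  intro R₀ hc
  induction R₀, hc using Nat.le_induction with
  | base => intro _; simp
  | succ R₀ hc ih =>
    intro hR₀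
    haveI : Fact (1 < L) := ⟨by omega⟩
    have hTL : T₀ ≤ L := by omega
    have hz2 : (i + R₀ : ZMod L) ≠ i + R₀ + 1 := fun h => one_ne_zero (left_eq_add.mp h)
    -- the column `R₀`, as words in its right links
    let e : ℕ → Edge 2 L := fun b => (![i + R₀ + 1, j + b], 1)
    let A : ℕ → GaugeConfig 2 L G → G := fun b U => U (![i + R₀, j + b], 0)
    let B : ℕ → GaugeConfig 2 L G → G := fun b U =>
      (U (![i + R₀, j + b + 1], 0))⁻¹ * (U (![i + R₀, j + b], 1))⁻¹
    let Ψ : GaugeConfig 2 L G → ℂ := fun U =>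
      Φ U * ∏ p ∈ (range R₀ ×ˢ range T₀).image (fun q : ℕ × ℕ => (![i + q.1, j + q.2] : Site 2 L)),
        (w (plaquetteHolonomy U p 0 1) : ℂ)
    have hev : ∀ e' : Edge 2 L, Continuous fun U : GaugeConfig 2 L G => U e' := fun e' => continuous_apply e'
    have he : ∀ b < T₀, ∀ b' < T₀, e b = e b' → b = b' := by
      intro b hb b' hb' h
      have h1 : (![i + R₀ + 1, j + b] : Site 2 L) = ![i + R₀ + 1, j + b'] := congrArg Prod.fst h
      have h2 := add_left_cancel (vec2_eq_iff.mp h1).2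
      by_contra hne
      exact natCast_zmod_ne_of_lt (L := L) (by omega) (by omega) hne h2
    have hA : ∀ b, Continuous (A b) := fun b => hev _
    have hB : ∀ b, Continuous (B b) := fun b => by
      show Continuous fun U : GaugeConfig 2 L G => (U (![i + R₀, j + b + 1], 0))⁻¹ * (U (![i + R₀, j + b], 1))⁻¹
      exact (hev ((![i + R₀, j + b + 1], 0) : Edge 2 L)).inv.mul (hev ((![i + R₀, j + b], 1) : Edge 2 L)).inv
    have hAe : ∀ b b' U g, A b (update U (e b') g) = A b U := by
      intro b b' U g
      show update U (![i + R₀ + 1, j + b'], 1) g (![i + R₀, j + b], 0) = U (![i + R₀, j + b], 0)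
      exact update_of_ne (fun h => absurd (congrArg Prod.snd h : (0 : Fin 2) = 1) (by decide)) _ _
    have hBe : ∀ b b' U g, B b (update U (e b') g) = B b U := by
      intro b b' U g
      show (update U (![i + R₀ + 1, j + b'], 1) g (![i + R₀, j + b + 1], 0))⁻¹ *
          (update U (![i + R₀ + 1, j + b'], 1) g (![i + R₀, j + b], 1))⁻¹ = _
      rw [update_of_ne (fun h => absurd (congrArg Prod.snd h : (0 : Fin 2) = 1) (by decide)),
        update_of_ne (fun h => hz2 (vec2_eq_iff.mp (congrArg Prod.fst h)).1)]
    have hΨ : Continuous Ψ :=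
      hΦ.mul (continuous_finsetProd _ fun p _ =>
        Complex.continuous_ofReal.comp (hw.comp (continuous_config_plaquetteHolonomy p 0 1)))
    have hΨe : ∀ b U g, Ψ (update U (e b) g) = Ψ U := by
      intro b U g
      show Φ (update U (![i + R₀ + 1, j + b], 1) g) * _ = Φ U * _
      have h1 := hΦe (R₀ + 1) (j + b) U g (by omega) hR₀
      push_cast at h1
      rw [← add_assoc] at h1
      rw [h1]
      congr 1
      exact Finset.prod_congr rfl fun p hp => by
        rw [plaquetteHolonomy_update_col_of_mem_rect i j hR₀ hp]
    have hword : ∀ (b : ℕ) (U : GaugeConfig 2 L G),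
        A b U * U (e b) * B b U = plaquetteHolonomy U ![i + R₀, j + b] 0 1 := by
      intro b U
      simp only [A, B, e, plaquetteHolonomy, shift_vec2_zero, shift_vec2_one, mul_assoc]
    have hpt : ∀ U : GaugeConfig 2 L G,
        Φ U * ∏ p ∈ (range (R₀ + 1) ×ˢ range T₀).image (fun q : ℕ × ℕ => (![i + q.1, j + q.2] : Site 2 L)),
            (w (plaquetteHolonomy U p 0 1) : ℂ) =
          (∏ b ∈ range T₀, (w (A b U * U (e b) * B b U) : ℂ)) * Ψ U := by
      intro U
      rw [prod_rect_succ_eq i j (R := R₀) (T := T₀) (by omega) hTL]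
      simp only [hword, Ψ]
      ring
    simp_rw [hpt]
    rw [integral_prod_words_mul hw T₀ e A B Ψ he hA hB hAe hBe hΨ hΨe, ih (by omega), ← mul_assoc, ← pow_add]
    congr 2
    have : R₀ + 1 - c = R₀ - c + 1 := by omega
    rw [this]
    ring

/-- **Peeling the columns to the LEFT**: if `Φ` ignores the vertical links of the columns `i + c'`, `c' < a₀`,
then `∫ Φ ∏_{(a₀+R')×T₀ at (i,j)} w = (∫w)^{a₀T₀} ∫ Φ ∏_{R'×T₀ at (i+a₀,j)} w` (`a₀ + R' + 1 ≤ L`). -/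
theorem integral_mul_prod_rect_peel_left (j : ZMod L) {T₀ : ℕ} (hT₀ : T₀ + 1 ≤ L) :
    ∀ (a₀ : ℕ) (i : ZMod L) {R' : ℕ}, a₀ + R' + 1 ≤ L →
      (∀ (c' : ℕ) (y : ZMod L) (U : GaugeConfig 2 L G) (g : G), c' < a₀ →
        Φ (update U (![i + c', y], 1) g) = Φ U) →
      ∫ U, Φ U * ∏ p ∈ (range (a₀ + R') ×ˢ range T₀).image (fun q : ℕ × ℕ => (![i + q.1, j + q.2] : Site 2 L)),
          (w (plaquetteHolonomy U p 0 1) : ℂ) ∂(Measure.pi fun _ : Edge 2 L => haarProbability G) =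
        (∫ g, (w g : ℂ) ∂(haarProbability G)) ^ (a₀ * T₀) *
          ∫ U, Φ U * ∏ p ∈ (range R' ×ˢ range T₀).image
              (fun q : ℕ × ℕ => (![i + a₀ + q.1, j + q.2] : Site 2 L)),
            (w (plaquetteHolonomy U p 0 1) : ℂ) ∂(Measure.pi fun _ : Edge 2 L => haarProbability G) := by
  intro a₀
  induction a₀ with
  | zero => intro i R' _ _; simp
  | succ a₀ ih =>
    intro i R' hL hΦe
    haveI : Fact (1 < L) := ⟨by omega⟩
    have hTL : T₀ ≤ L := by omega
    have hz2 : (i + 1 : ZMod L) ≠ i := fun h => one_ne_zero ((add_eq_left).mp h)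
    -- the column `i`, as words in its (inverted) left links
    let e : ℕ → Edge 2 L := fun b => (![i, j + b], 1)
    let A : ℕ → GaugeConfig 2 L G → G := fun b U =>
      U (![i, j + b], 0) * U (![i + 1, j + b], 1) * (U (![i, j + b + 1], 0))⁻¹
    let B : ℕ → GaugeConfig 2 L G → G := fun _ _ => 1
    let Ψ : GaugeConfig 2 L G → ℂ := fun U =>
      Φ U * ∏ p ∈ (range (a₀ + R') ×ˢ range T₀).image
        (fun q : ℕ × ℕ => (![i + 1 + q.1, j + q.2] : Site 2 L)), (w (plaquetteHolonomy U p 0 1) : ℂ)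
    have hev : ∀ e' : Edge 2 L, Continuous fun U : GaugeConfig 2 L G => U e' := fun e' => continuous_apply e'
    have he : ∀ b < T₀, ∀ b' < T₀, e b = e b' → b = b' := by
      intro b hb b' hb' h
      have h1 : (![i, j + b] : Site 2 L) = ![i, j + b'] := congrArg Prod.fst h
      have h2 := add_left_cancel (vec2_eq_iff.mp h1).2
      by_contra hne
      exact natCast_zmod_ne_of_lt (L := L) (by omega) (by omega) hne h2
    have hA : ∀ b, Continuous (A b) := fun b => by
      show Continuous fun U : GaugeConfig 2 L G =>
        U (![i, j + b], 0) * U (![i + 1, j + b], 1) * (U (![i, j + b + 1], 0))⁻¹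
      exact ((hev _).mul (hev _)).mul (hev ((![i, j + b + 1], 0) : Edge 2 L)).inv
    have hB : ∀ b, Continuous (B b) := fun _ => continuous_const
    have hAe : ∀ b b' U g, A b (update U (e b') g) = A b U := by
      intro b b' U g
      show update U (![i, j + b'], 1) g (![i, j + b], 0) * update U (![i, j + b'], 1) g (![i + 1, j + b], 1) *
          (update U (![i, j + b'], 1) g (![i, j + b + 1], 0))⁻¹ = _
      rw [update_of_ne (fun h => absurd (congrArg Prod.snd h : (0 : Fin 2) = 1) (by decide)),
        update_of_ne (fun h => hz2 (vec2_eq_iff.mp (congrArg Prod.fst h)).1),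
        update_of_ne (fun h => absurd (congrArg Prod.snd h : (0 : Fin 2) = 1) (by decide))]
    have hBe : ∀ b b' U g, B b (update U (e b') g) = B b U := fun _ _ _ _ => rfl
    have hΨ : Continuous Ψ :=
      hΦ.mul (continuous_finsetProd _ fun p _ =>
        Complex.continuous_ofReal.comp (hw.comp (continuous_config_plaquetteHolonomy p 0 1)))
    have hΨe : ∀ b U g, Ψ (update U (e b) g) = Ψ U := by
      intro b U g
      show Φ (update U (![i, j + b], 1) g) * _ = Φ U * _
      have h1 := hΦe 0 (j + b) U g (by omega)
      simp only [Nat.cast_zero, add_zero] at h1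
      rw [h1]
      congr 1
      exact Finset.prod_congr rfl fun p hp => by
        rw [plaquetteHolonomy_update_leftcol_of_mem_rect i j (by omega) hp]
    have hword : ∀ (b : ℕ) (U : GaugeConfig 2 L G),
        A b U * (U (e b))⁻¹ * B b U = plaquetteHolonomy U ![i, j + b] 0 1 := by
      intro b U
      simp only [A, B, e, plaquetteHolonomy, shift_vec2_zero, shift_vec2_one, mul_one]
    have hpt : ∀ U : GaugeConfig 2 L G,
        Φ U * ∏ p ∈ (range (a₀ + 1 + R') ×ˢ range T₀).image
            (fun q : ℕ × ℕ => (![i + q.1, j + q.2] : Site 2 L)), (w (plaquetteHolonomy U p 0 1) : ℂ) =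
          (∏ b ∈ range T₀, (w (A b U * (U (e b))⁻¹ * B b U) : ℂ)) * Ψ U := by
      intro U
      rw [show a₀ + 1 + R' = (a₀ + R') + 1 by omega,
        prod_rect_succ_left i j (R := a₀ + R') (T := T₀) (by omega) hTL]
      simp only [hword, Ψ]
      ring
    simp_rw [hpt]
    rw [integral_prod_invWords_mul hw T₀ e A B Ψ he hA hB hAe hBe hΨ hΨe,
      ih (i + 1) (R' := R') (by omega) (fun c' y U g hc' => by
        have h1 := hΦe (c' + 1) y U g (by omega)
        push_cast at h1
        rw [show (i : ZMod L) + 1 + (c' : ZMod L) = i + ((c' : ZMod L) + 1) by ring]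
        exact h1),
      ← mul_assoc, ← pow_add,
      show (i : ZMod L) + 1 + (a₀ : ZMod L) = i + ((a₀ + 1 : ℕ) : ZMod L) by push_cast; ring]
    congr 2
    ring

/-- **Peeling the rows ABOVE row `c`**: if `Φ` ignores the horizontal links of the rows `j + r`,
`c < r ≤ L − 1`, then for `c ≤ T₀`, `T₀ + 1 ≤ L`:
`∫ Φ ∏_{R×T₀ at (i,j)} w = (∫w)^{R(T₀−c)} ∫ Φ ∏_{R×c at (i,j)} w`. -/
theorem integral_mul_prod_rect_peel_top (i j : ZMod L) {R c : ℕ} (hR : R + 1 ≤ L)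
    (hΦe : ∀ (r : ℕ) (x : ZMod L) (U : GaugeConfig 2 L G) (g : G), c < r → r + 1 ≤ L →
      Φ (update U (![x, j + r], 0) g) = Φ U) :
    ∀ (T₀ : ℕ), c ≤ T₀ → T₀ + 1 ≤ L →
      ∫ U, Φ U * ∏ p ∈ (range R ×ˢ range T₀).image (fun q : ℕ × ℕ => (![i + q.1, j + q.2] : Site 2 L)),
          (w (plaquetteHolonomy U p 0 1) : ℂ) ∂(Measure.pi fun _ : Edge 2 L => haarProbability G) =
        (∫ g, (w g : ℂ) ∂(haarProbability G)) ^ (R * (T₀ - c)) *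
          ∫ U, Φ U * ∏ p ∈ (range R ×ˢ range c).image (fun q : ℕ × ℕ => (![i + q.1, j + q.2] : Site 2 L)),
            (w (plaquetteHolonomy U p 0 1) : ℂ) ∂(Measure.pi fun _ : Edge 2 L => haarProbability G) := by
  intro T₀ hc
  induction T₀, hc using Nat.le_induction with
  | base => intro _; simp
  | succ T₀ hc ih =>
    intro hT₀
    haveI : Fact (1 < L) := ⟨by omega⟩
    have hRL : R ≤ L := by omega
    have hz2 : (j + T₀ : ZMod L) ≠ j + T₀ + 1 := fun h => one_ne_zero (left_eq_add.mp h)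
    -- the row `T₀`, as words in its (inverted) top links
    let e : ℕ → Edge 2 L := fun a => (![i + a, j + T₀ + 1], 0)
    let A : ℕ → GaugeConfig 2 L G → G := fun a U => U (![i + a, j + T₀], 0) * U (![i + a + 1, j + T₀], 1)
    let B : ℕ → GaugeConfig 2 L G → G := fun a U => (U (![i + a, j + T₀], 1))⁻¹
    let Ψ : GaugeConfig 2 L G → ℂ := fun U =>
      Φ U * ∏ p ∈ (range R ×ˢ range T₀).image (fun q : ℕ × ℕ => (![i + q.1, j + q.2] : Site 2 L)),
        (w (plaquetteHolonomy U p 0 1) : ℂ)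
    have hev : ∀ e' : Edge 2 L, Continuous fun U : GaugeConfig 2 L G => U e' := fun e' => continuous_apply e'
    have he : ∀ a < R, ∀ a' < R, e a = e a' → a = a' := by
      intro a ha a' ha' h
      have h1 : (![i + a, j + T₀ + 1] : Site 2 L) = ![i + a', j + T₀ + 1] := congrArg Prod.fst h
      have h2 := add_left_cancel (vec2_eq_iff.mp h1).1
      by_contra hne
      exact natCast_zmod_ne_of_lt (L := L) (by omega) (by omega) hne h2
    have hA : ∀ a, Continuous (A a) := fun a => (hev _).mul (hev _)
    have hB : ∀ a, Continuous (B a) := fun a => by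
      show Continuous fun U : GaugeConfig 2 L G => (U (![i + a, j + T₀], 1))⁻¹
      exact (hev ((![i + a, j + T₀], 1) : Edge 2 L)).inv
    have hAe : ∀ a a' U g, A a (update U (e a') g) = A a U := by
      intro a a' U g
      show update U (![i + a', j + T₀ + 1], 0) g (![i + a, j + T₀], 0) *
          update U (![i + a', j + T₀ + 1], 0) g (![i + a + 1, j + T₀], 1) = _
      rw [update_of_ne (fun h => hz2 (vec2_eq_iff.mp (congrArg Prod.fst h)).2),
        update_of_ne (fun h => absurd (congrArg Prod.snd h : (1 : Fin 2) = 0) (by decide))]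
    have hBe : ∀ a a' U g, B a (update U (e a') g) = B a U := by
      intro a a' U g
      show (update U (![i + a', j + T₀ + 1], 0) g (![i + a, j + T₀], 1))⁻¹ = _
      rw [update_of_ne (fun h => absurd (congrArg Prod.snd h : (1 : Fin 2) = 0) (by decide))]
    have hΨ : Continuous Ψ :=
      hΦ.mul (continuous_finsetProd _ fun p _ =>
        Complex.continuous_ofReal.comp (hw.comp (continuous_config_plaquetteHolonomy p 0 1)))
    have hΨe : ∀ a U g, Ψ (update U (e a) g) = Ψ U := by
      intro a U g
      show Φ (update U (![i + a, j + T₀ + 1], 0) g) * _ = Φ U * _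
      have h1 := hΦe (T₀ + 1) (i + a) U g (by omega) hT₀
      push_cast at h1
      rw [← add_assoc] at h1
      rw [h1]
      congr 1
      exact Finset.prod_congr rfl fun p hp => by
        rw [plaquetteHolonomy_update_toprow_of_mem_rect i j hT₀ hp]
    have hword : ∀ (a : ℕ) (U : GaugeConfig 2 L G),
        A a U * (U (e a))⁻¹ * B a U = plaquetteHolonomy U ![i + a, j + T₀] 0 1 := by
      intro a U
      simp only [A, B, e, plaquetteHolonomy, shift_vec2_zero, shift_vec2_one]
    have hpt : ∀ U : GaugeConfig 2 L G,
        Φ U * ∏ p ∈ (range R ×ˢ range (T₀ + 1)).image (fun q : ℕ × ℕ => (![i + q.1, j + q.2] : Site 2 L)),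
            (w (plaquetteHolonomy U p 0 1) : ℂ) =
          (∏ a ∈ range R, (w (A a U * (U (e a))⁻¹ * B a U) : ℂ)) * Ψ U := by
      intro U
      rw [prod_rect_succ_top i j (R := R) (T := T₀) hRL (by omega)]
      simp only [hword, Ψ]
      ring
    simp_rw [hpt]
    rw [integral_prod_invWords_mul hw R e A B Ψ he hA hB hAe hBe hΨ hΨe, ih (by omega), ← mul_assoc,
      ← pow_add]
    congr 2
    have : T₀ + 1 - c = T₀ - c + 1 := by omega
    rw [this]
    ring

/-- **Peeling the rows BELOW**: if `Φ` ignores the horizontal links of the rows `j + r`, `r < b₀`, then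
`∫ Φ ∏_{R×(b₀+T') at (i,j)} w = (∫w)^{R b₀} ∫ Φ ∏_{R×T' at (i, j+b₀)} w` (`b₀ + T' + 1 ≤ L`). -/
theorem integral_mul_prod_rect_peel_bottom (i : ZMod L) {R : ℕ} (hR : R + 1 ≤ L) :
    ∀ (b₀ : ℕ) (j : ZMod L) {T' : ℕ}, b₀ + T' + 1 ≤ L →
      (∀ (r : ℕ) (x : ZMod L) (U : GaugeConfig 2 L G) (g : G), r < b₀ →
        Φ (update U (![x, j + r], 0) g) = Φ U) →
      ∫ U, Φ U * ∏ p ∈ (range R ×ˢ range (b₀ + T')).image (fun q : ℕ × ℕ => (![i + q.1, j + q.2] : Site 2 L)),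
          (w (plaquetteHolonomy U p 0 1) : ℂ) ∂(Measure.pi fun _ : Edge 2 L => haarProbability G) =
        (∫ g, (w g : ℂ) ∂(haarProbability G)) ^ (R * b₀) *
          ∫ U, Φ U * ∏ p ∈ (range R ×ˢ range T').image
              (fun q : ℕ × ℕ => (![i + q.1, j + b₀ + q.2] : Site 2 L)),
            (w (plaquetteHolonomy U p 0 1) : ℂ) ∂(Measure.pi fun _ : Edge 2 L => haarProbability G) := by
  intro b₀
  induction b₀ with
  | zero => intro j T' _ _; simp
  | succ b₀ ih =>
    intro j T' hL hΦe
    haveI : Fact (1 < L) := ⟨by omega⟩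
    have hRL : R ≤ L := by omega
    have hz2 : (j + 1 : ZMod L) ≠ j := fun h => one_ne_zero ((add_eq_left).mp h)
    -- the row `j`, as words in its bottom links
    let e : ℕ → Edge 2 L := fun a => (![i + a, j], 0)
    let A : ℕ → GaugeConfig 2 L G → G := fun _ _ => 1
    let B : ℕ → GaugeConfig 2 L G → G := fun a U =>
      U (![i + a + 1, j], 1) * (U (![i + a, j + 1], 0))⁻¹ * (U (![i + a, j], 1))⁻¹
    let Ψ : GaugeConfig 2 L G → ℂ := fun U =>
      Φ U * ∏ p ∈ (range R ×ˢ range (b₀ + T')).image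
        (fun q : ℕ × ℕ => (![i + q.1, j + 1 + q.2] : Site 2 L)), (w (plaquetteHolonomy U p 0 1) : ℂ)
    have hev : ∀ e' : Edge 2 L, Continuous fun U : GaugeConfig 2 L G => U e' := fun e' => continuous_apply e'
    have he : ∀ a < R, ∀ a' < R, e a = e a' → a = a' := by
      intro a ha a' ha' h
      have h1 : (![i + a, j] : Site 2 L) = ![i + a', j] := congrArg Prod.fst h
      have h2 := add_left_cancel (vec2_eq_iff.mp h1).1
      by_contra hne
      exact natCast_zmod_ne_of_lt (L := L) (by omega) (by omega) hne h2
    have hA : ∀ a, Continuous (A a) := fun _ => continuous_const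
    have hB : ∀ a, Continuous (B a) := fun a => by
      show Continuous fun U : GaugeConfig 2 L G =>
        U (![i + a + 1, j], 1) * (U (![i + a, j + 1], 0))⁻¹ * (U (![i + a, j], 1))⁻¹
      exact ((hev _).mul (hev ((![i + a, j + 1], 0) : Edge 2 L)).inv).mul
        (hev ((![i + a, j], 1) : Edge 2 L)).inv
    have hAe : ∀ a a' U g, A a (update U (e a') g) = A a U := fun _ _ _ _ => rfl
    have hBe : ∀ a a' U g, B a (update U (e a') g) = B a U := by
      intro a a' U g
      show update U (![i + a', j], 0) g (![i + a + 1, j], 1) * (update U (![i + a', j], 0) g (![i + a, j + 1], 0))⁻¹ *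
          (update U (![i + a', j], 0) g (![i + a, j], 1))⁻¹ = _
      rw [update_of_ne (fun h => absurd (congrArg Prod.snd h : (1 : Fin 2) = 0) (by decide)),
        update_of_ne (fun h => hz2 (vec2_eq_iff.mp (congrArg Prod.fst h)).2),
        update_of_ne (fun h => absurd (congrArg Prod.snd h : (1 : Fin 2) = 0) (by decide))]
    have hΨ : Continuous Ψ :=
      hΦ.mul (continuous_finsetProd _ fun p _ =>
        Complex.continuous_ofReal.comp (hw.comp (continuous_config_plaquetteHolonomy p 0 1)))
    have hΨe : ∀ a U g, Ψ (update U (e a) g) = Ψ U := by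
      intro a U g
      show Φ (update U (![i + a, j], 0) g) * _ = Φ U * _
      have h1 := hΦe 0 (i + a) U g (by omega)
      simp only [Nat.cast_zero, add_zero] at h1
      rw [h1]
      congr 1
      exact Finset.prod_congr rfl fun p hp => by
        rw [plaquetteHolonomy_update_bottomrow_of_mem_rect i j (by omega) hp]
    have hword : ∀ (a : ℕ) (U : GaugeConfig 2 L G),
        A a U * U (e a) * B a U = plaquetteHolonomy U ![i + a, j] 0 1 := by
      intro a U
      simp only [A, B, e, plaquetteHolonomy, shift_vec2_zero, shift_vec2_one, one_mul, mul_assoc]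
    have hpt : ∀ U : GaugeConfig 2 L G,
        Φ U * ∏ p ∈ (range R ×ˢ range (b₀ + 1 + T')).image
            (fun q : ℕ × ℕ => (![i + q.1, j + q.2] : Site 2 L)), (w (plaquetteHolonomy U p 0 1) : ℂ) =
          (∏ a ∈ range R, (w (A a U * U (e a) * B a U) : ℂ)) * Ψ U := by
      intro U
      rw [show b₀ + 1 + T' = (b₀ + T') + 1 by omega,
        prod_rect_succ_bottom i j (R := R) (T := b₀ + T') hRL (by omega)]
      simp only [hword, Ψ]
      ring
    simp_rw [hpt]
    rw [integral_prod_words_mul hw R e A B Ψ he hA hB hAe hBe hΨ hΨe,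
      ih (j + 1) (T' := T') (by omega) (fun r x U g hr => by
        have h1 := hΦe (r + 1) x U g (by omega)
        push_cast at h1
        rw [show (j : ZMod L) + 1 + (r : ZMod L) = j + ((r : ZMod L) + 1) by ring]
        exact h1),
      ← mul_assoc, ← pow_add,
      show (j : ZMod L) + 1 + (b₀ : ZMod L) = j + ((b₀ + 1 : ℕ) : ZMod L) by push_cast; ring]
    congr 2
    ring

end Peel


end Summit.Ventures.LatticeQCDFlow.Scoring
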